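import Mathlib.LinearAlgebra.Matrix.Permanent
import Mathlib.Analysis.Complex.Basic
import Mathlib.Data.Fintype.CardEmbedding
import Mathlib.GroupTheory.Perm.Fin
import Mathlib.Algebra.Order.Chebyshev
import HarnessLib

/-!
# Carlen–Lieb–Loss: an inequality of Hadamard type for permanents (topic `Analysis/Matrix`)

Named facts for route ValiantsHypothesis/OneNatPerBit — support `ProductAnchor`
(stmt-ValiantsHypothesis-10324, which IS Theorem 1.1 below in squared "correlation" form) and the
`K`-row tool the planner names for the ABP induction (`ABPCorrelationLaw`, stmt-10317; "cite fact
wanted later: CarlenLiebLoss2006 Thm 3.1"). READ on the arXiv text arXiv:math/0508096 (= Methods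
Appl. Anal. 13 (2006) 1–17), pp. 3 and 8:

* **Theorem 1.1** (p. 3, verbatim): "Let `F` be an `N × N` complex matrix whose `j`th column is
  the vector `f_j` in `ℂᴺ`. Let `|f_j|²` denote the sum of the absolute squares of the entries of
  `f_j`. … For any vectors `f_1, …, f_N` in `ℂᴺ` we have the inequality
  `|perm(F)| ≤ (N!/N^{N/2}) ∏_{j=1}^N |f_j|`.  For `N > 2`, there is equality iff at least one of
  the vectors `f_j` is zero, or else `F` is a rank one matrix and each `f_j` is a constant modulus
  vector."
* **Theorem 3.1** (p. 8, verbatim, `K ≤ N` vectors `f_1, …, f_K ∈ ℂᴺ` forming the ROWS of a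
  `K × N` matrix, `𝒫(f_1, …, f_K) := [Σ_{1 ≤ j_1 < ⋯ < j_K ≤ N} (perm [f_{i,j_t}]_{i,t ≤ K})²]^{1/2}`,
  the `ℓ²`-norm of the vector of `K × K` sub-permanents; `𝒫 = perm` when `K = N`):
  "`𝒫(f_1, …, f_K) ≤ √(N choose K) · (K!/N^{K/2}) ∏_{j=1}^K |f_j|`.  If `K ≥ 2` and none of the
  vectors `f_i` is the zero vector, then equality holds iff `[f_1, …, f_K]` is a rank one matrix,
  and each of the vectors `f_i` is a constant modulus vector."

## Lean rendering

* `perm` is Mathlib's `Matrix.permanent` (`∑ σ, ∏ i, M (σ i) i`; `permanent_transpose`, so the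
  row/column choice is immaterial); entries in `ℂ` with `‖·‖`; both inequalities are recorded
  SQUARED (both sides are `≥ 0`, so this is equivalent and avoids `√` and real powers):
  Thm 1.1 ⇝ `‖perm F‖² · N^N ≤ (N!)² · ∏_j Σ_i ‖F i j‖²`;
* in Thm 3.1 the sum over `K`-subsets `j_1 < ⋯ < j_K` is rendered as the sum over ORDERED injective
  `K`-tuples `e : Fin K ↪ Fin N` (a `Fintype`), which counts every subset `K!` times with the same
  `|perm|` (permanents are invariant under column permutations): `K! · 𝒫² = Σ_e |perm(F ∘ e)|²`, so
  the printed `𝒫² ≤ (N choose K)(K!)² N^{−K} ∏|f_i|²` becomes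
  `(Σ_e ‖perm (F.submatrix id e)‖²) · N^K ≤ (K!)² · N(N−1)⋯(N−K+1) · ∏_i Σ_j ‖F i j‖²`
  (`Nat.descFactorial N K = K! · (N choose K)`); for complex entries `(perm ⋯)²` in the printed
  `𝒫` is read as `|perm ⋯|²` (p. 5: "the left hand side is only increased if we replace each entry
  … by its absolute value, and the right hand side is unchanged", so the complex form follows from
  the non-negative one proved in §3);
* the equality cases are NOT recorded. No side conditions are needed (`N = 0`, `K = 0`, `K > N`
  are trivially true as typed).

`ProductAnchor` of the route is literally Thm 1.1 squared for the array `a i j = F j i`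
(`Σ_σ ∏_i a i (σ i) = perm aᵀ = perm a`).

Theorem 1.1 is ALSO recorded unsquared, exactly as printed (`CarlenLiebLoss2006_thm_1_1`, the
form vendored independently by grounder g18-3 as p54063 and inadvertently overwritten when this
file was re-proposed whole as p54083; restored here), and the two renderings are PROVED equivalent
(`carlenLiebLoss_permanent_sq_le_iff_thm_1_1`), so they count as one fact for discharge purposes.

## References

* E. A. Carlen, E. H. Lieb, M. Loss, *An inequality of Hadamard type for permanents*, Methods
  Appl. Anal. 13 (2006) 1–17; arXiv:math/0508096, Thm. 1.1 (p. 3), Thm. 3.1 (p. 8).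
  [CarlenLiebLoss2006]
-/

namespace Literature.Analysis.Matrix

open scoped BigOperators

/-- NAMED FACT (**Carlen–Lieb–Loss 2006, Theorem 1.1**: "For any vectors `f_1, …, f_N` in `ℂᴺ`
[the columns of `F`] we have the inequality `|perm(F)| ≤ (N!/N^{N/2}) ∏_{j=1}^N |f_j|`", `|f_j|`
the `ℓ²` norm), squared: for every complex `N × N` matrix `F`,
`|perm F|² · N^N ≤ (N!)² · ∏_j (Σ_i |F_{ij}|²)`. Sharp (equality at rank-one constant-modulus
`F`, e.g. the all-ones matrix: `(N!)² N^N = (N!)² N^N`). Grounds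
`Summit.ValiantsHypothesis.ValiantsHypothesis.Theses.OneNatPerBit.ProductAnchor` (= this fact for
`Fᵀ`, via `Matrix.permanent_transpose`). Users take `(h : carlenLiebLoss_permanent_sq_le)`.
[cite: CarlenLiebLoss2006, Thm. 1.1 (p. 3)] -/
def carlenLiebLoss_permanent_sq_le : Prop :=
  ∀ (N : ℕ) (F : _root_.Matrix (Fin N) (Fin N) ℂ),
    ‖F.permanent‖ ^ 2 * (N : ℝ) ^ N ≤ (N.factorial : ℝ) ^ 2 * ∏ j, ∑ i, ‖F i j‖ ^ 2

/-- NAMED FACT (**Carlen–Lieb–Loss 2006, Theorem 3.1**, the `K`-row sub-permanent bound: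
"`𝒫(f_1, …, f_K) ≤ √(N choose K) (K!/N^{K/2}) ∏_{j=1}^K |f_j|`", where `f_1, …, f_K ∈ ℂᴺ` are the
rows of a `K × N` matrix `F` and `𝒫²` is the sum over `K`-subsets `j_1 < ⋯ < j_K` of the columns of
`|perm|²` of the corresponding `K × K` minor), squared and with the subset sum written over
ordered injective `K`-tuples (`Σ_{e : Fin K ↪ Fin N} = K! · Σ_{subsets}`):
`(Σ_e |perm (F.submatrix id e)|²) · N^K ≤ (K!)² · N^{(K)} · ∏_i (Σ_j |F_{ij}|²)` with
`N^{(K)} = N(N−1)⋯(N−K+1) = Nat.descFactorial N K`. For `K = N` this is `N!` times Theorem 1.1.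
Users take `(h : carlenLiebLoss_subpermanent_sq_le)`.
[cite: CarlenLiebLoss2006, Thm. 3.1 (p. 8)] -/
def carlenLiebLoss_subpermanent_sq_le : Prop :=
  ∀ (K N : ℕ) (F : _root_.Matrix (Fin K) (Fin N) ℂ),
    (∑ e : Fin K ↪ Fin N, ‖(F.submatrix id e).permanent‖ ^ 2) * (N : ℝ) ^ K ≤
      (K.factorial : ℝ) ^ 2 * (N.descFactorial K : ℝ) * ∏ i, ∑ j, ‖F i j‖ ^ 2

/-- NAMED FACT (**Carlen–Lieb–Loss 2006, Theorem 1.1**, as printed, unsquared): "For any vectors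
`f_1, …, f_N` in `ℂᴺ` [the columns of the `N × N` matrix `F`] we have the inequality
`|perm(F)| ≤ (N!/N^{N/2}) ∏_{j=1}^N |f_j|`", with `|f_j| = √(Σ_i |F_{ij}|²)` and
`N^{N/2} = √(N^N)`. Equality cases not recorded. Equivalent to `carlenLiebLoss_permanent_sq_le`
(`carlenLiebLoss_permanent_sq_le_iff_thm_1_1`, proved). Users take
`(h : CarlenLiebLoss2006_thm_1_1)`. [cite: CarlenLiebLoss2006, Thm. 1.1 (p. 3)] -/
def CarlenLiebLoss2006_thm_1_1 : Prop :=
  ∀ (N : ℕ) (F : _root_.Matrix (Fin N) (Fin N) ℂ),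
    ‖F.permanent‖ ≤ (N.factorial : ℝ) / Real.sqrt ((N : ℝ) ^ N) *
      ∏ j, Real.sqrt (∑ i, ‖F i j‖ ^ 2)

/-- The squared and the printed (unsquared) renderings of Carlen–Lieb–Loss Thm. 1.1 are
equivalent (both sides are non-negative and `N^N ≥ 1`). [folklore] -/
theorem carlenLiebLoss_permanent_sq_le_iff_thm_1_1 :
    carlenLiebLoss_permanent_sq_le ↔ CarlenLiebLoss2006_thm_1_1 := by
  unfold carlenLiebLoss_permanent_sq_le CarlenLiebLoss2006_thm_1_1
  refine forall_congr' fun N => forall_congr' fun F => ?_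
  have hb : (0 : ℝ) < (N : ℝ) ^ N := by
    rcases Nat.eq_zero_or_pos N with rfl | hN
    · simp
    · exact pow_pos (Nat.cast_pos.mpr hN) N
  have hs : ∀ j, 0 ≤ ∑ i, ‖F i j‖ ^ 2 := fun j => Finset.sum_nonneg fun i _ => by positivity
  have hR : 0 ≤ (N.factorial : ℝ) / Real.sqrt ((N : ℝ) ^ N) * ∏ j, Real.sqrt (∑ i, ‖F i j‖ ^ 2) :=
    mul_nonneg (div_nonneg (Nat.cast_nonneg _) (Real.sqrt_nonneg _))
      (Finset.prod_nonneg fun j _ => Real.sqrt_nonneg _)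
  have hsq : ((N.factorial : ℝ) / Real.sqrt ((N : ℝ) ^ N) * ∏ j, Real.sqrt (∑ i, ‖F i j‖ ^ 2)) ^ 2
      = (N.factorial : ℝ) ^ 2 * (∏ j, ∑ i, ‖F i j‖ ^ 2) / (N : ℝ) ^ N := by
    rw [mul_pow, div_pow, Real.sq_sqrt hb.le, ← Finset.prod_pow]
    rw [Finset.prod_congr rfl fun j _ => Real.sq_sqrt (hs j)]
    ring
  rw [← pow_le_pow_iff_left₀ (norm_nonneg _) hR two_ne_zero, hsq, le_div_iff₀ hb]

/-!
## Discharge of Theorem 3.1 (`carlenLiebLoss_subpermanent_sq_le_holds`) and, as its case `K = N`,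
## of Theorem 1.1 (`carlenLiebLoss_permanent_sq_le_holds`, `CarlenLiebLoss2006_thm_1_1_holds`)

We formalize the paper's SECOND proof (§3, pp. 8–9 of arXiv:math/0508096: "based on induction and
the arithmetic–geometric mean inequality"), in the tree's ordered-tuple rendering
`S_K(F) := Σ_{e : Fin K ↪ Fin N} |perm (F.submatrix id e)|²` (`= K! · 𝒫²`):

1. reduction to real non-negative entries (p. 8, "we may assume that all entries of each vector are
   non negative"): `|perm M| ≤ perm |M|` entrywise (`norm_permanent_le`), so the complex statement
   follows from the real one for the matrix of moduli (`real_subperm_sq_le`, which in fact holds for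
   all real matrices);
2. Laplace expansion of each `(K+1) × (K+1)` minor along the first row (`perm_laplace_row_zero`,
   the permanent twin of Mathlib's `Matrix.det_succ_row_zero`; p. 8,
   `perm = Σ_k f_{1,j_k} a_{j_1 … ĵ_k … j_K}`);
3. the two uses of `2xy ≤ x² + y²` on the cross terms (p. 8, "we estimate the last term using the
   arithmetic–geometric mean inequality in two different ways"): with `x_k := f(j_k)·a(ĵ_k)`,
   `y_{kl} := f(j_k)·a(ĵ_l)`, (i) `(Σ_k x_k)² ≤ (K+1)·Σ_k x_k²` (Cauchy–Schwarz,
   `sq_sum_le_card_mul_sum_sq`) and (ii) `(Σ_k x_k)² ≤ Σ_{k,l} y_{kl}²` (`sq_sum_le_sum_sum_sq`);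
   the paper's convex combination with `α = (N-K)/N` is taken with denominators cleared:
   `N·(Σx)² ≤ (K+1)·(Σ_{k,l} y² + (N-K-1)·Σ_k x²)`;
4. the bookkeeping of p. 8 bottom – p. 9 top (summing out the free index `j_2`, which takes
   `N-K+1` values, and symmetrizing the position of `j_1`): the bijection
   `(Fin (K+1) ↪ Fin N) ≃ Σ_{i : Fin K ↪ Fin N} (range i)ᶜ` splitting off one position
   (`Equiv.embeddingCongr (finSuccEquiv' l)` followed by `Function.Embedding.optionEmbeddingEquiv`;
   `sum_embedding_split`), giving `sum_D`, `sum_Y`; the coefficients `1+(K-1)α = (1-α)(N-K+1)`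
   of (3.9) appear as the identity `out(i) + in(i) = |f_1|²` (`sum_out_add_in`), whence the
   one-row recursion `N · S_{K+1}(A) ≤ (K+1)²·(N-K)·|f_1|²·S_K(A')` (`key_ineq`; p. 9,
   "`𝒫² ≤ K(N-K+1)/N · 1/(K-1)! · Σ_{j_1} f² Σ' a²`");
5. induction on `K` (p. 8, "The proof proceeds by induction in `K`"; `real_subperm_sq_le`), using
   `N^(K+1) = (N-K)·N^(K)` (`Nat.descFactorial_succ`); for `K > N` there are no injective tuples
   and the left side is `0`.

The equality cases (p. 9) are not formalized (not part of the named fact).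
[cite: CarlenLiebLoss2006, Thm. 3.1 and its proof, §3 pp. 8–9]
-/

section DischargeThm31

open Equiv Finset

section Laplace

variable {R : Type*} [CommSemiring R]

/-- **Laplace expansion of the permanent along column `0`** (the permanent twin of Mathlib's
`Matrix.det_succ_column_zero`, same proof without signs: split `S_{n+1}` by the image of `0`
(`Finset.univ_perm_fin_succ`) and realign the embedding of `S_n` by the cycle `(0 1 … i)`
(`Fin.succAbove_cycleRange`, `Matrix.permanent_permute_cols`)). [folklore] -/
theorem perm_laplace_col_zero {n : ℕ} (A : _root_.Matrix (Fin n.succ) (Fin n.succ) R) :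
    A.permanent = ∑ i : Fin n.succ, A i 0 * (A.submatrix i.succAbove Fin.succ).permanent := by
  rw [Matrix.permanent, Finset.univ_perm_fin_succ, ← Finset.univ_product_univ]
  simp only [Finset.sum_map, Equiv.toEmbedding_apply, Finset.sum_product]
  refine Finset.sum_congr rfl fun p _ => ?_
  have key : ∀ τ : Perm (Fin n), ∏ i, A (Perm.decomposeFin.symm (p, τ) i) i =
      A p 0 * ∏ i, A (Equiv.swap 0 p (τ i).succ) i.succ := fun τ => by
    rw [Fin.prod_univ_succ, Perm.decomposeFin_symm_apply_zero]
    simp only [Perm.decomposeFin_symm_apply_succ]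
  simp only [key, ← Finset.mul_sum]
  congr 1
  refine Fin.cases ?_ (fun i => ?_) p
  · simp only [Equiv.swap_self, Equiv.refl_apply, Matrix.permanent, Matrix.submatrix_apply,
      Fin.succAbove_zero]
  · rw [← Matrix.permanent_permute_cols i.cycleRange, Matrix.permanent]
    refine Finset.sum_congr rfl fun τ _ => Finset.prod_congr rfl fun j _ => ?_
    simp only [Matrix.submatrix_apply, id, Fin.succAbove_cycleRange]

/-- **Laplace expansion of the permanent along row `0`** (from the column version by
`Matrix.permanent_transpose`). [folklore] -/
theorem perm_laplace_row_zero {n : ℕ} (A : _root_.Matrix (Fin n.succ) (Fin n.succ) R) :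
    A.permanent = ∑ j : Fin n.succ, A 0 j * (A.submatrix Fin.succ j.succAbove).permanent := by
  rw [← Matrix.permanent_transpose A, perm_laplace_col_zero]
  refine Finset.sum_congr rfl fun i _ => ?_
  rw [← Matrix.permanent_transpose]
  simp only [Matrix.transpose_apply, Matrix.transpose_submatrix, Matrix.transpose_transpose]

end Laplace

/-- `|perm M| ≤ perm (|M_{ij}|)_{ij}` (triangle inequality and `‖∏‖ = ∏ ‖·‖` in `ℂ`); this is the
reduction "we may assume that all entries of each vector are non negative" (p. 8). [folklore] -/
theorem norm_permanent_le {n : Type*} [Fintype n] [DecidableEq n] (M : _root_.Matrix n n ℂ) :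
    ‖M.permanent‖ ≤ (_root_.Matrix.of fun i j => ‖M i j‖).permanent := by
  unfold Matrix.permanent
  refine (norm_sum_le _ _).trans (le_of_eq ?_)
  refine Finset.sum_congr rfl fun σ _ => ?_
  rw [norm_prod]
  rfl

/-- Splitting off position `l` of an injective `(K+1)`-tuple: summing `G (j l, j ∘ succAbove l)`
over all `j : Fin (K+1) ↪ Fin N` is summing `G c i` over `i : Fin K ↪ Fin N` and `c ∉ range i`
(the bijection `Equiv.embeddingCongr (finSuccEquiv' l) ≫ Function.Embedding.optionEmbeddingEquiv`).
This is the paper's "summing out" of a free index over its `N-K+1` admissible values (p. 8).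
[folklore] -/
private theorem sum_embedding_split {K N : ℕ} (l : Fin (K + 1))
    (G : Fin N → (Fin K ↪ Fin N) → ℝ) :
    ∑ j : Fin (K + 1) ↪ Fin N, G (j l) ((Fin.succAboveEmb l).trans j) =
      ∑ i : Fin K ↪ Fin N, ∑ c ∈ (Finset.univ.map i)ᶜ, G c i := by
  -- the splitting bijection `E`
  have hfst : ∀ j : Fin (K + 1) ↪ Fin N,
      (((Equiv.embeddingCongr (finSuccEquiv' l) (Equiv.refl (Fin N))).trans
        (Function.Embedding.optionEmbeddingEquiv (Fin K) (Fin N))) j).1 =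
        (Fin.succAboveEmb l).trans j := fun j => by
    ext m
    simp [Function.Embedding.optionEmbeddingEquiv, Equiv.embeddingCongr]
  have hsnd : ∀ j : Fin (K + 1) ↪ Fin N,
      ((((Equiv.embeddingCongr (finSuccEquiv' l) (Equiv.refl (Fin N))).trans
        (Function.Embedding.optionEmbeddingEquiv (Fin K) (Fin N))) j).2 : Fin N) = j l :=
    fun j => by
    simp [Function.Embedding.optionEmbeddingEquiv, Equiv.embeddingCongr]
  rw [← ((Equiv.embeddingCongr (finSuccEquiv' l) (Equiv.refl (Fin N))).trans
    (Function.Embedding.optionEmbeddingEquiv (Fin K) (Fin N))).symm.sum_comp, Fintype.sum_sigma]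
  refine Fintype.sum_congr _ _ fun i => ?_
  rw [Finset.sum_subtype (Finset.univ.map i)ᶜ (p := fun c => c ∈ (Set.range ⇑i)ᶜ)
    (fun c => by simp)]
  refine Fintype.sum_congr _ _ fun c => ?_
  have h1 := hfst (((Equiv.embeddingCongr (finSuccEquiv' l) (Equiv.refl (Fin N))).trans
    (Function.Embedding.optionEmbeddingEquiv (Fin K) (Fin N))).symm ⟨i, c⟩)
  have h2 := hsnd (((Equiv.embeddingCongr (finSuccEquiv' l) (Equiv.refl (Fin N))).trans
    (Function.Embedding.optionEmbeddingEquiv (Fin K) (Fin N))).symm ⟨i, c⟩)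
  rw [Equiv.apply_symm_apply] at h1 h2
  rw [← h1, ← h2]

/-- `#(range i)ᶜ = N - K` for an injective `K`-tuple in `Fin N`. [folklore] -/
private theorem card_compl_map {K N : ℕ} (hKN : K ≤ N) (i : Fin K ↪ Fin N) :
    (((Finset.univ.map i)ᶜ).card : ℝ) = (N : ℝ) - K := by
  rw [Finset.card_compl, Finset.card_map, Finset.card_univ, Fintype.card_fin, Fintype.card_fin,
    Nat.cast_sub hKN]

/-- `out(i) + in(i) = |f|²`: the squares of `f` outside and inside the range of `i` add up to the
full `ℓ²` mass — the identity behind the choice `1 + (K-1)α = (1-α)(N-K+1)` of p. 9. [folklore] -/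
private theorem sum_out_add_in {K N : ℕ} (f : Fin N → ℝ) (i : Fin K ↪ Fin N) :
    ∑ c ∈ (Finset.univ.map i)ᶜ, f c ^ 2 + ∑ m, f (i m) ^ 2 = ∑ c, f c ^ 2 := by
  have : ∑ c ∈ Finset.univ.map i, f c ^ 2 = ∑ m, f (i m) ^ 2 := Finset.sum_map _ _ _
  rw [← this, Finset.sum_compl_add_sum]

/-- The "diagonal" sum: `Σ_j Σ_k (f (j k) · a (ĵ_k))² = (K+1) · Σ_i out(i) · a(i)²`
(the `α`-term of (3.7)–(3.8), p. 8). [folklore] -/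
private theorem sum_D {K N : ℕ} (f : Fin N → ℝ) (a : (Fin K ↪ Fin N) → ℝ) :
    ∑ j : Fin (K + 1) ↪ Fin N, ∑ k, (f (j k) * a ((Fin.succAboveEmb k).trans j)) ^ 2 =
      ((K : ℝ) + 1) * ∑ i : Fin K ↪ Fin N, (∑ c ∈ (Finset.univ.map i)ᶜ, f c ^ 2) * a i ^ 2 := by
  rw [Finset.sum_comm]
  have : ∀ k : Fin (K + 1),
      ∑ j : Fin (K + 1) ↪ Fin N, (f (j k) * a ((Fin.succAboveEmb k).trans j)) ^ 2 =
      ∑ i : Fin K ↪ Fin N, (∑ c ∈ (Finset.univ.map i)ᶜ, f c ^ 2) * a i ^ 2 := fun k => by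
    rw [sum_embedding_split k (fun c i => (f c * a i) ^ 2)]
    refine Finset.sum_congr rfl fun i _ => ?_
    rw [Finset.sum_mul]
    refine Finset.sum_congr rfl fun c _ => ?_
    ring
  simp only [this, Finset.sum_const, Finset.card_univ, Fintype.card_fin, nsmul_eq_mul,
    Nat.cast_add, Nat.cast_one]

/-- The full quadratic sum: `Σ_j Σ_k Σ_l (f (j k) · a (ĵ_l))² = (K+1) · Σ_i (out(i) + (N-K)·in(i)) · a(i)²`
(the `(1-α)`-term of (3.7)–(3.8) together with the diagonal; the factor `N-K` is the paper's
`N-K+1` for `K+1` rows, p. 8 bottom). [folklore] -/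
private theorem sum_Y {K N : ℕ} (hKN : K ≤ N) (f : Fin N → ℝ) (a : (Fin K ↪ Fin N) → ℝ) :
    ∑ j : Fin (K + 1) ↪ Fin N, ∑ k, ∑ l, (f (j k) * a ((Fin.succAboveEmb l).trans j)) ^ 2 =
      ((K : ℝ) + 1) * ∑ i : Fin K ↪ Fin N,
        ((∑ c ∈ (Finset.univ.map i)ᶜ, f c ^ 2) + ((N : ℝ) - K) * ∑ m, f (i m) ^ 2) * a i ^ 2 := by
  have h1 : ∀ j : Fin (K + 1) ↪ Fin N,
      ∑ k, ∑ l, (f (j k) * a ((Fin.succAboveEmb l).trans j)) ^ 2 =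
      ∑ l, (f (j l) ^ 2 + ∑ m, f (((Fin.succAboveEmb l).trans j) m) ^ 2) *
        a ((Fin.succAboveEmb l).trans j) ^ 2 := fun j => by
    rw [Finset.sum_comm]
    refine Finset.sum_congr rfl fun l _ => ?_
    rw [Fin.sum_univ_succAbove _ l]
    simp only [Function.Embedding.trans_apply, Fin.coe_succAboveEmb, add_mul, Finset.sum_mul,
      mul_pow]
  simp_rw [h1]
  rw [Finset.sum_comm]
  have h2 : ∀ l : Fin (K + 1), ∑ j : Fin (K + 1) ↪ Fin N,
      (f (j l) ^ 2 + ∑ m, f (((Fin.succAboveEmb l).trans j) m) ^ 2) *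
        a ((Fin.succAboveEmb l).trans j) ^ 2 =
      ∑ i : Fin K ↪ Fin N,
        ((∑ c ∈ (Finset.univ.map i)ᶜ, f c ^ 2) + ((N : ℝ) - K) * ∑ m, f (i m) ^ 2) * a i ^ 2 :=
    fun l => by
    rw [sum_embedding_split l (fun c i => (f c ^ 2 + ∑ m, f (i m) ^ 2) * a i ^ 2)]
    refine Finset.sum_congr rfl fun i _ => ?_
    rw [← Finset.sum_mul, Finset.sum_add_distrib, Finset.sum_const, nsmul_eq_mul,
      card_compl_map hKN i]
  simp only [h2, Finset.sum_const, Finset.card_univ, Fintype.card_fin, nsmul_eq_mul,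
    Nat.cast_add, Nat.cast_one]

/-- The second use of `2xy ≤ x² + y²` (p. 8): if `x_k x_l = y_{kl} y_{lk}` for all `k, l`, then
`(Σ_k x_k)² ≤ Σ_k Σ_l y_{kl}²`. [folklore] -/
private theorem sq_sum_le_sum_sum_sq {ι : Type*} [Fintype ι] (x : ι → ℝ) (y : ι → ι → ℝ)
    (h : ∀ k l, x k * x l = y k l * y l k) :
    (∑ k, x k) ^ 2 ≤ ∑ k, ∑ l, y k l ^ 2 := by
  have hsym : ∑ k, ∑ l, y l k ^ 2 = ∑ k, ∑ l, y k l ^ 2 := Finset.sum_comm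
  have h1 : (∑ k, x k) ^ 2 = ∑ k, ∑ l, x k * x l := by rw [sq, Finset.sum_mul_sum]
  have h1' : 2 * ∑ k, ∑ l, x k * x l = ∑ k, ∑ l, 2 * (x k * x l) := by
    simp only [Finset.mul_sum]
  have h2 : ∑ k, ∑ l, 2 * (x k * x l) ≤ ∑ k, ∑ l, (y k l ^ 2 + y l k ^ 2) := by
    gcongr with k _ l _
    rw [h]
    nlinarith [sq_nonneg (y k l - y l k)]
  have h3 : ∑ k, ∑ l, (y k l ^ 2 + y l k ^ 2) =
      ((∑ k, ∑ l, y k l ^ 2) + ∑ k, ∑ l, y l k ^ 2) := by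
    simp only [Finset.sum_add_distrib]
  rw [h1]
  linarith [h2, h3, hsym]

/-- **The one-row recursion** (paper (3.8)–(3.9) with `α = (N-K)/N`, denominators cleared, for
`K+1` rows): for `K+1 ≤ N`, any `f : Fin N → ℝ` (the first row) and any weights `a` on injective
`K`-tuples (the sub-permanents of the remaining rows),
`N · Σ_j (Σ_k f(j_k) a(ĵ_k))² ≤ (K+1)² (N-K) · |f|² · Σ_i a(i)²`.
[cite: CarlenLiebLoss2006, proof of Thm. 3.1, pp. 8–9] -/
private theorem key_ineq {K N : ℕ} (hKN : K + 1 ≤ N) (f : Fin N → ℝ) (a : (Fin K ↪ Fin N) → ℝ) :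
    (N : ℝ) * ∑ j : Fin (K + 1) ↪ Fin N, (∑ k, f (j k) * a ((Fin.succAboveEmb k).trans j)) ^ 2 ≤
      ((K : ℝ) + 1) ^ 2 * ((N : ℝ) - K) * (∑ c, f c ^ 2) * ∑ i, a i ^ 2 := by
  have hK1 : (0 : ℝ) ≤ (N : ℝ) - K - 1 := by
    have : ((K : ℝ) + 1) ≤ N := by exact_mod_cast hKN
    linarith
  have hK0 : (0 : ℝ) ≤ (K : ℝ) + 1 := by positivity
  -- the pointwise bound (two AM-GM uses, convex combination cleared of denominators)
  have hpt : ∀ j : Fin (K + 1) ↪ Fin N,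
      (N : ℝ) * (∑ k, f (j k) * a ((Fin.succAboveEmb k).trans j)) ^ 2 ≤
        ((K : ℝ) + 1) * (∑ k, ∑ l, (f (j k) * a ((Fin.succAboveEmb l).trans j)) ^ 2
          + ((N : ℝ) - K - 1) * ∑ k, (f (j k) * a ((Fin.succAboveEmb k).trans j)) ^ 2) := by
    intro j
    have hCS : (∑ k, f (j k) * a ((Fin.succAboveEmb k).trans j)) ^ 2 ≤
        ((K : ℝ) + 1) * ∑ k, (f (j k) * a ((Fin.succAboveEmb k).trans j)) ^ 2 := by
      have := sq_sum_le_card_mul_sum_sq (s := Finset.univ)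
        (f := fun k => f (j k) * a ((Fin.succAboveEmb k).trans j))
      simpa using this
    have hAM : (∑ k, f (j k) * a ((Fin.succAboveEmb k).trans j)) ^ 2 ≤
        ∑ k, ∑ l, (f (j k) * a ((Fin.succAboveEmb l).trans j)) ^ 2 :=
      sq_sum_le_sum_sum_sq _ (fun k l => f (j k) * a ((Fin.succAboveEmb l).trans j))
        fun k l => by ring
    have h1 := mul_le_mul_of_nonneg_left hCS hK1
    have h2 := mul_le_mul_of_nonneg_left hAM hK0
    linarith
  -- `out + in = |f|²` makes both coefficients equal to `N-K`
  have hS : (∑ i : Fin K ↪ Fin N,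
      ((∑ c ∈ (Finset.univ.map i)ᶜ, f c ^ 2) + ((N : ℝ) - K) * ∑ m, f (i m) ^ 2) * a i ^ 2) +
      ((N : ℝ) - K - 1) * ∑ i : Fin K ↪ Fin N, (∑ c ∈ (Finset.univ.map i)ᶜ, f c ^ 2) * a i ^ 2 =
      ((N : ℝ) - K) * (∑ c, f c ^ 2) * ∑ i, a i ^ 2 := by
    rw [Finset.mul_sum, Finset.mul_sum, ← Finset.sum_add_distrib]
    refine Finset.sum_congr rfl fun i _ => ?_
    rw [← sum_out_add_in f i]
    ring
  calc (N : ℝ) * ∑ j : Fin (K + 1) ↪ Fin N, (∑ k, f (j k) * a ((Fin.succAboveEmb k).trans j)) ^ 2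
      = ∑ j : Fin (K + 1) ↪ Fin N,
          (N : ℝ) * (∑ k, f (j k) * a ((Fin.succAboveEmb k).trans j)) ^ 2 := by
        rw [Finset.mul_sum]
    _ ≤ ∑ j : Fin (K + 1) ↪ Fin N, ((K : ℝ) + 1) *
          (∑ k, ∑ l, (f (j k) * a ((Fin.succAboveEmb l).trans j)) ^ 2
            + ((N : ℝ) - K - 1) * ∑ k, (f (j k) * a ((Fin.succAboveEmb k).trans j)) ^ 2) :=
        Finset.sum_le_sum fun j _ => hpt j
    _ = ((K : ℝ) + 1) *
          ((∑ j : Fin (K + 1) ↪ Fin N, ∑ k, ∑ l, (f (j k) * a ((Fin.succAboveEmb l).trans j)) ^ 2)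
          + ((N : ℝ) - K - 1) *
            ∑ j : Fin (K + 1) ↪ Fin N, ∑ k, (f (j k) * a ((Fin.succAboveEmb k).trans j)) ^ 2) := by
        rw [← Finset.mul_sum, Finset.sum_add_distrib, ← Finset.mul_sum]
    _ = ((K : ℝ) + 1) ^ 2 * ((∑ i : Fin K ↪ Fin N,
          ((∑ c ∈ (Finset.univ.map i)ᶜ, f c ^ 2) + ((N : ℝ) - K) * ∑ m, f (i m) ^ 2) * a i ^ 2) +
          ((N : ℝ) - K - 1) *
            ∑ i : Fin K ↪ Fin N, (∑ c ∈ (Finset.univ.map i)ᶜ, f c ^ 2) * a i ^ 2) := by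
        rw [sum_Y (by omega) f a, sum_D f a]
        ring
    _ = ((K : ℝ) + 1) ^ 2 * ((N : ℝ) - K) * (∑ c, f c ^ 2) * ∑ i, a i ^ 2 := by
        rw [hS]
        ring

/-- Laplace expansion of a `(K+1) × (K+1)` column-minor along row `0`
(p. 8: `perm = Σ_k f_{1,j_k} a_{j_1,…,ĵ_k,…,j_K}`). [folklore] -/
private theorem perm_submatrix_succ {K N : ℕ} (A : _root_.Matrix (Fin (K + 1)) (Fin N) ℝ)
    (j : Fin (K + 1) ↪ Fin N) :
    (A.submatrix id ⇑j).permanent =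
      ∑ k, A 0 (j k) * (A.submatrix Fin.succ ⇑((Fin.succAboveEmb k).trans j)).permanent := by
  rw [perm_laplace_row_zero]
  rfl

/-- **CLL Thm. 3.1 for real matrices** (squared, ordered injective tuples; in fact for ALL real
entries, the AM-GM steps being `2xy ≤ x² + y²`): by induction on the number of rows `K`
(p. 8), the step being `key_ineq` applied to the first row and the sub-permanents of the other rows.
[cite: CarlenLiebLoss2006, Thm. 3.1] -/
theorem real_subperm_sq_le (N : ℕ) : ∀ (K : ℕ) (A : _root_.Matrix (Fin K) (Fin N) ℝ),
    (∑ e : Fin K ↪ Fin N, (A.submatrix id ⇑e).permanent ^ 2) * (N : ℝ) ^ K ≤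
      (K.factorial : ℝ) ^ 2 * (N.descFactorial K : ℝ) * ∏ i, ∑ j, A i j ^ 2 := by
  intro K
  induction K with
  | zero =>
    intro A
    simp [Matrix.permanent_isEmpty]
  | succ K ih =>
    intro A
    by_cases hKN : K + 1 ≤ N
    · have hkey := key_ineq hKN (fun c => A 0 c)
        (fun i : Fin K ↪ Fin N => (A.submatrix Fin.succ ⇑i).permanent)
      have hih := ih (A.submatrix Fin.succ id)
      simp only [Matrix.submatrix_submatrix, Function.comp_id, Function.id_comp,
        Matrix.submatrix_apply, id_eq] at hih
      simp only [← perm_submatrix_succ] at hkey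
      have hNp : (0 : ℝ) ≤ (N : ℝ) ^ K := by positivity
      have hF0 : (0 : ℝ) ≤ ∑ c, A 0 c ^ 2 := Finset.sum_nonneg fun c _ => sq_nonneg _
      have hNK : (0 : ℝ) ≤ (N : ℝ) - K := by
        have : (K : ℝ) + 1 ≤ N := by exact_mod_cast hKN
        linarith
      rw [Nat.factorial_succ, Nat.descFactorial_succ, Fin.prod_univ_succ, pow_succ]
      push_cast [Nat.cast_sub (by omega : K ≤ N)]
      calc (∑ e : Fin (K + 1) ↪ Fin N, (A.submatrix id ⇑e).permanent ^ 2) * ((N : ℝ) ^ K * N)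
          = ((N : ℝ) * ∑ e : Fin (K + 1) ↪ Fin N, (A.submatrix id ⇑e).permanent ^ 2) *
              (N : ℝ) ^ K := by ring
        _ ≤ (((K : ℝ) + 1) ^ 2 * ((N : ℝ) - K) * (∑ c, A 0 c ^ 2) *
              ∑ i : Fin K ↪ Fin N, (A.submatrix Fin.succ ⇑i).permanent ^ 2) * (N : ℝ) ^ K :=
            mul_le_mul_of_nonneg_right hkey hNp
        _ = ((K : ℝ) + 1) ^ 2 * ((N : ℝ) - K) * (∑ c, A 0 c ^ 2) *
              ((∑ i : Fin K ↪ Fin N, (A.submatrix Fin.succ ⇑i).permanent ^ 2) * (N : ℝ) ^ K) := by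
            ring
        _ ≤ ((K : ℝ) + 1) ^ 2 * ((N : ℝ) - K) * (∑ c, A 0 c ^ 2) *
              ((K.factorial : ℝ) ^ 2 * (N.descFactorial K : ℝ) *
                ∏ i : Fin K, ∑ j, A i.succ j ^ 2) :=
            mul_le_mul_of_nonneg_left hih (by positivity)
        _ = _ := by ring
    · have hlt : Fintype.card (Fin N) < Fintype.card (Fin (K + 1)) := by
        simp only [Fintype.card_fin]; omega
      haveI : IsEmpty (Fin (K + 1) ↪ Fin N) := Function.Embedding.isEmpty_of_card_lt hlt
      simp only [Finset.univ_eq_empty, Finset.sum_empty, zero_mul]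
      positivity

/-- **DISCHARGE of `carlenLiebLoss_subpermanent_sq_le` (Carlen–Lieb–Loss 2006, Thm. 3.1)**:
the real theorem `real_subperm_sq_le` applied to the matrix of moduli, via
`|perm (F ∘ e)| ≤ perm (|F| ∘ e)` (`norm_permanent_le`).
[cite: CarlenLiebLoss2006, Thm. 3.1 (p. 8), proof §3 pp. 8–9] -/
theorem carlenLiebLoss_subpermanent_sq_le_holds : carlenLiebLoss_subpermanent_sq_le := by
  intro K N F
  have h2 := real_subperm_sq_le N K (_root_.Matrix.of fun i j => ‖F i j‖)
  calc (∑ e : Fin K ↪ Fin N, ‖(F.submatrix id ⇑e).permanent‖ ^ 2) * (N : ℝ) ^ K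
      ≤ (∑ e : Fin K ↪ Fin N,
          ((_root_.Matrix.of fun i j => ‖F i j‖).submatrix id ⇑e).permanent ^ 2) * (N : ℝ) ^ K := by
        gcongr with e _
        exact norm_permanent_le (F.submatrix id ⇑e)
    _ ≤ _ := h2
    _ = _ := rfl

end DischargeThm31

/-- **DISCHARGE of `carlenLiebLoss_permanent_sq_le` (Carlen–Lieb–Loss 2006, Thm. 1.1, squared)**:
the case `K = N` of Thm. 3.1 (p. 8: "Because of (3.2) Theorem 3.1 reduces to Theorem 1.1 in the case
`K = N`"), applied to `Fᵀ` (rows of `Fᵀ` = columns of `F`); each of the `N!` injective `N`-tuples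
`e` is a permutation and `perm (Fᵀ ∘ e) = perm F` (`Matrix.permanent_permute_cols`,
`Matrix.permanent_transpose`), so the `K = N` instance reads `N! · |perm F|² · N^N ≤ (N!)² · N! · ∏`.
[cite: CarlenLiebLoss2006, Thm. 1.1 (p. 3), via Thm. 3.1 with `K = N` (p. 8)] -/
theorem carlenLiebLoss_permanent_sq_le_holds : carlenLiebLoss_permanent_sq_le := by
  intro N F
  have h := carlenLiebLoss_subpermanent_sq_le_holds N N F.transpose
  have hterm : ∀ e : Fin N ↪ Fin N, (F.transpose.submatrix id ⇑e).permanent = F.permanent := by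
    intro e
    have hbij : Function.Bijective e := e.injective.bijective_of_finite
    have : F.transpose.submatrix id ⇑e = (F.submatrix ⇑(Equiv.ofBijective e hbij) id).transpose := by
      ext i j
      rfl
    rw [this, Matrix.permanent_transpose, Matrix.permanent_permute_cols]
  simp only [hterm, Finset.sum_const, Finset.card_univ, Fintype.card_embedding_eq,
    Fintype.card_fin, Nat.descFactorial_self, nsmul_eq_mul, Matrix.transpose_apply] at h
  have hpos : (0 : ℝ) < N.factorial := by exact_mod_cast N.factorial_pos
  have key : (N.factorial : ℝ) * (‖F.permanent‖ ^ 2 * (N : ℝ) ^ N) ≤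
      (N.factorial : ℝ) * ((N.factorial : ℝ) ^ 2 * ∏ j, ∑ i, ‖F i j‖ ^ 2) := by
    calc (N.factorial : ℝ) * (‖F.permanent‖ ^ 2 * (N : ℝ) ^ N)
        = (N.factorial : ℝ) * ‖F.permanent‖ ^ 2 * (N : ℝ) ^ N := by ring
      _ ≤ (N.factorial : ℝ) ^ 2 * (N.factorial : ℝ) * ∏ j, ∑ i, ‖F i j‖ ^ 2 := h
      _ = _ := by ring
  exact le_of_mul_le_mul_left key hpos

/-- **DISCHARGE of `CarlenLiebLoss2006_thm_1_1` (Thm. 1.1 as printed, unsquared)**, from the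
squared form by the proved equivalence `carlenLiebLoss_permanent_sq_le_iff_thm_1_1`.
[cite: CarlenLiebLoss2006, Thm. 1.1 (p. 3)] -/
theorem CarlenLiebLoss2006_thm_1_1_holds : CarlenLiebLoss2006_thm_1_1 :=
  carlenLiebLoss_permanent_sq_le_iff_thm_1_1.mp carlenLiebLoss_permanent_sq_le_holds

end Literature.Analysis.Matrix
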